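import Mathlib
import Summits.Ventures.PercRepro.TriangleCapStarStability

/-!
# PercRepro — THE STABILITY OF THE PAIR COUNT UNDER A MAXIMUM-DEGREE BOUND: a triangle-free graph with `s ≥ 4` edges
and every degree `≤ s − 2` has `Σ_v d(v)² + 4 (s − 3) ≤ s (s + 1)` — the double broom (a star of `s − 2` edges and
two more edges at a second vertex, sharing leaves) is the extremal graph; on the bipartite class: a spanning
subgraph of `K(A, Aᶜ)` with `s` missing cross pairs, no vertex missing `s − 1` of them, is `4 (s − 3)` below its
bipartite closed form (p3, gen 47; part 200q)

§10bt's stability (`sum_deg_sq_le_of_not_star`: no vertex on every edge ⇒ `Σ d² + 2 (s − 2) ≤ s (s + 1)`) read one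
level further: with `v₀` of maximum degree `Δ ≤ s − 2` and `s − Δ ≥ 2` edges off `v₀`, every ordered adjacent pair
off `v₀` avoids `≥ Δ − 1` edges at `v₀` (`nonIncident_ge_of_off`) and the pairs at `v₀` avoid `≥ (s − Δ)(Δ − 1)` edges
in all (`sum_nonIncident_at_ge`), so `Σ d² + 2 (s − Δ)(Δ − 1) ≤ s (s + 1)`; for `3 ≤ Δ ≤ s − 2` the concave product
`(s − Δ)(Δ − 1)` is at least `2 (s − 3)`, and for `Δ ≤ 2` every `d² ≤ 2d` gives `Σ d² ≤ 4s ≤ s (s + 1) − 4 (s − 3)`.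
This is the bipartite bound the cells `r ≥ a + 1` of the stability table need (the other bipartition has more
missing pairs than a star at a non-isolated vertex can hold). Axioms: standard.
-/

namespace PercRepro

namespace TriangleCap

namespace C047

open Finset

variable {V : Type*} [Fintype V] [DecidableEq V]

/-- **THE STABILITY OF THE PAIR COUNT UNDER `Δ ≤ s − 2`:** a triangle-free graph with `s ≥ 4` edges and every degree
`≤ s − 2` has `Σ_v d(v)² + 4 (s − 3) ≤ s (s + 1)`. -/
theorem sum_deg_sq_le_of_maxdeg (H : SimpleGraph V) [DecidableRel H.Adj] (hfree : H.CliqueFree 3)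
    (hs : 4 ≤ H.edgeFinset.card) (hΔ : ∀ v, deg H v + 2 ≤ H.edgeFinset.card) :
    ∑ v, deg H v * deg H v + 4 * (H.edgeFinset.card - 3) ≤ H.edgeFinset.card * (H.edgeFinset.card + 1) := by
  have hsum := sum_adjPairsAll_nonIncident_eq H
  rw [sum_adjPairsAll_deg_add] at hsum
  have hne : (univ : Finset V).Nonempty := by
    obtain ⟨e, he⟩ := card_pos.mp (by omega : 0 < H.edgeFinset.card)
    revert he
    refine Sym2.ind (fun x y _ => ⟨x, mem_univ x⟩) e
  obtain ⟨v₀, -, hmax⟩ := exists_max_image univ (fun v => deg H v) hne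
  have hoff : (H.edgeFinset.filter (fun e => v₀ ∉ e)).card + deg H v₀ = H.edgeFinset.card := by
    have := card_filter_add_card_filter_not (s := H.edgeFinset) (fun e => v₀ ∉ e)
    have h2 : H.edgeFinset.filter (fun e => ¬ v₀ ∉ e) = H.incidenceFinset v₀ := by
      ext e
      simp only [mem_filter, SimpleGraph.mem_incidenceFinset, SimpleGraph.mem_edgeFinset, not_not]
      rfl
    rw [h2, ← deg_eq_card_incidenceFinset] at this
    exact this
  rcases Nat.lt_or_ge (deg H v₀) 3 with hΔ2 | hΔ3
  · -- every degree `≤ 2`: `Σ d² ≤ 2 Σ d = 4 s`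
    have hall : ∀ v, deg H v * deg H v ≤ 2 * deg H v := by
      intro v
      have := hmax v (mem_univ v)
      have : deg H v ≤ 2 := by omega
      interval_cases h : deg H v <;> omega
    have h3 := sum_deg_eq H
    have h4 : ∑ v, deg H v * deg H v ≤ ∑ v, 2 * deg H v := sum_le_sum (fun v _ => hall v)
    rw [← mul_sum, h3] at h4
    obtain ⟨m', hm'⟩ : ∃ m', H.edgeFinset.card = m' + 4 := ⟨H.edgeFinset.card - 4, by omega⟩
    rw [hm'] at h4 ⊢
    have e : m' + 4 - 3 = m' + 1 := by omega
    rw [e]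
    nlinarith [h4]
  · -- `Σ nonIncident ≥ 4 s′ (Δ − 1)`, `s′ = s − Δ ≥ 2`
    have hsplit := sum_filter_add_sum_filter_not (adjPairsAll H) (fun p : V × V => p.1 ≠ v₀ ∧ p.2 ≠ v₀)
      (fun p => nonIncident H p.1 p.2)
    have hP1 : ((adjPairsAll H).filter (fun p : V × V => p.1 ≠ v₀ ∧ p.2 ≠ v₀)).card * (deg H v₀ - 1) ≤
        ∑ p ∈ (adjPairsAll H).filter (fun p : V × V => p.1 ≠ v₀ ∧ p.2 ≠ v₀), nonIncident H p.1 p.2 := by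
      rw [← smul_eq_mul, ← sum_const]
      apply sum_le_sum
      intro p hp
      rw [mem_filter, mem_adjPairsAll] at hp
      have := nonIncident_ge_of_off H hfree v₀ hp.1 hp.2.1 hp.2.2
      omega
    have hP2 := sum_nonIncident_at_eq H v₀
    have hP2' := sum_nonIncident_at_ge H hfree v₀
    have hcard := card_adjPairs_off_vertex H v₀
    set s' := (H.edgeFinset.filter (fun e => v₀ ∉ e)).card with hs'
    set Δ := deg H v₀ with hΔ'
    have hΔs := hΔ v₀
    clear_value s' Δ
    -- the arithmetic: `(s′)(Δ − 1) ≥ 2 (s − 3)` for `3 ≤ Δ ≤ s − 2`, `s′ = s − Δ`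
    have key : 2 * (H.edgeFinset.card - 3) ≤ s' * (Δ - 1) := by
      obtain ⟨d, rfl⟩ : ∃ d, Δ = d + 3 := ⟨Δ - 3, by omega⟩
      obtain ⟨t, rfl⟩ : ∃ t, s' = t + 2 := ⟨s' - 2, by omega⟩
      have : H.edgeFinset.card = t + d + 5 := by omega
      rw [this]
      have e1 : t + d + 5 - 3 = t + d + 2 := by omega
      have e2 : d + 3 - 1 = d + 2 := by omega
      rw [e1, e2]
      nlinarith [Nat.zero_le (t * d)]
    rw [← hsplit] at hsum
    have hP1' : 2 * s' * (Δ - 1) ≤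
        ∑ p ∈ (adjPairsAll H).filter (fun p : V × V => p.1 ≠ v₀ ∧ p.2 ≠ v₀), nonIncident H p.1 p.2 := by
      have : ((adjPairsAll H).filter (fun p : V × V => p.1 ≠ v₀ ∧ p.2 ≠ v₀)).card = 2 * s' := by omega
      rw [this] at hP1
      exact hP1
    nlinarith [hsum, hP1', hP2, hP2', key]

/-- **THE STABILITY ON THE BIPARTITE CLASS UNDER A MAXIMUM-DEGREE BOUND:** a spanning subgraph of `K(A, Aᶜ)`,
`|A| = a`, with `s ≥ 4` missing cross pairs (`s + 1 ≤ k`), no vertex missing more than `s − 2` of them, has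
`Σ_v d(v)² + s (k − 1 − s) + 4 (s − 3) ≤ m k`. -/
theorem closed_form_stability_bipSub_maxdeg (D : SimpleGraph V) [DecidableRel D.Adj] (A : Finset V)
    (hD : BipSub D A) (a s : ℕ) (hA : A.card = a) (hm : D.edgeFinset.card + s = a * (Fintype.card V - a))
    (hs1 : s + 1 ≤ Fintype.card V) (hs4 : 4 ≤ s) (hmax : ∀ v, deg (missingGraph D A) v + 2 ≤ s) :
    ∑ v, deg D v * deg D v + s * (Fintype.card V - 1 - s) + 4 * (s - 3) ≤
      D.edgeFinset.card * Fintype.card V := by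
  have key := sum_deg_sq_bipSub D A hD
  have hM := card_edges_missingGraph D A hD a s hA hm
  rw [hM, hA] at key
  have hfree := cliqueFree_of_bipSub (missingGraph D A) A (bipSub_missingGraph D A)
  have hstab := sum_deg_sq_le_of_maxdeg (missingGraph D A) hfree (by rw [hM]; exact hs4)
    (fun v => by rw [hM]; exact hmax v)
  rw [hM] at hstab
  obtain ⟨t, ht⟩ : ∃ t, Fintype.card V = s + 1 + t := ⟨_, (Nat.add_sub_cancel' hs1).symm⟩
  have e : s + 1 + t - 1 - s = t := by omega
  rw [ht, e]
  rw [ht] at key hm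
  obtain ⟨s', rfl⟩ : ∃ s', s = s' + 4 := ⟨s - 4, by omega⟩
  have e2 : s' + 4 - 3 = s' + 1 := by omega
  rw [e2] at hstab ⊢
  generalize hS : ∑ v, deg D v * deg D v = S at key
  generalize hH : ∑ v, deg (missingGraph D A) v * deg (missingGraph D A) v = H at key hstab
  generalize hM' : D.edgeFinset.card = M at key hm
  generalize hP : a * (s' + 4 + 1 + t - a) = P at key hm
  nlinarith [key, hm, hstab]

end C047

end TriangleCap

end PercRepro
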